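import Summits.AtomisticToContinuum.Crystallization.Theorems.PalmUnimodularRigidityShellsToBarlowChartTransportOpsDefs

/-!
# Line `develop-the-model-growth-descent` (crux `ShellsToBarlowChart`, stmt-AtomisticToContinuum-9227): pattern facts, part 10

Decidable facts (the link of a site: STAR image, LINK rows, lower-apex formulas, enumerations) about the two integer kissing patterns `fcc3Int`, `hcpInt` (labels at squared
norm `18`) used by the frame transports of `stub_transportSystem`: hexagons, even/odd caps,
their filters, apexes, distance tables, lower caps and the letters read on them.  Every fact was
first verified by brute force (work/sim/facts.py of the lead's folder) and is proved here by
`decide` (split into small files so that each elaborates quickly).  All `[folklore]`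
(finite checks on the cuboctahedron / anticuboctahedron, HalesDSP2012 §1.3).
-/

namespace Summit.AtomisticToContinuum.Crystallization.Theorems.PalmUnimodularRigidityShellsToBarlowChart

open Literature.Geometry.DiscreteGeometry Literature.MathematicalPhysics.StatisticalMechanics

/-- LINK (fcc_m), row of the offset `(1, 0, -1)` (label `(c + b)`): touching among the twelve link labels is `linkAdj`. [folklore] -/
theorem linkRow_fcc_m_10 : ∀ y ∈ linkOffsets (-1) (-1), ∀ a ∈ fcc3Int, ∀ b ∈ fcc3Int, ∀ c ∈ fcc3Int, sqNormInt (a - b) = 18 → hexLabels a b ⊆ fcc3Int → c ∉ hexLabels a b → c + a ∈ fcc3Int → c + b ∈ fcc3Int → (sqNormInt (((if (((1 : ℤ), (0 : ℤ), ((-1) : ℤ))).1 = 1 then c else if (((1 : ℤ), (0 : ℤ), ((-1) : ℤ))).1 = -1 then (-c) else 0) - (((1 : ℤ), (0 : ℤ), ((-1) : ℤ))).2.1 • a - (((1 : ℤ), (0 : ℤ), ((-1) : ℤ))).2.2 • b) - ((if y.1 = 1 then c else if y.1 = -1 then (-c) else 0) - y.2.1 • a - y.2.2 • b)) = 18 ↔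 linkAdj (-1) (-1) ((1 : ℤ), (0 : ℤ), ((-1) : ℤ)) y) := by
  decide

/-- LINK (fcc_m), row of the offset `(1, 0, 0)` (label `(c)`): touching among the twelve link labels is `linkAdj`. [folklore] -/
theorem linkRow_fcc_m_11 : ∀ y ∈ linkOffsets (-1) (-1), ∀ a ∈ fcc3Int, ∀ b ∈ fcc3Int, ∀ c ∈ fcc3Int, sqNormInt (a - b) = 18 → hexLabels a b ⊆ fcc3Int → c ∉ hexLabels a b → c + a ∈ fcc3Int → c + b ∈ fcc3Int → (sqNormInt (((if (((1 : ℤ), (0 : ℤ), (0 : ℤ))).1 = 1 then c else if (((1 : ℤ), (0 : ℤ), (0 : ℤ))).1 = -1 then (-c) else 0) - (((1 : ℤ), (0 : ℤ), (0 : ℤ))).2.1 • a - (((1 : ℤ), (0 : ℤ), (0 : ℤ))).2.2 • b) - ((if y.1 = 1 then c else if y.1 = -1 then (-c) else 0) - y.2.1 • a - y.2.2 • b)) = 18 ↔ linkAdj (-1) (-1) ((1 : ℤ), (0 : ℤ), (0 : ℤ)) y) := by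
  decide

/-- HCP (even cap): the lower cap is the mirror cap with apex `c − (Σc/6·4)·(1,1,1)`. [folklore] -/
theorem lowerCap_formula_hcp_p : ∀ a ∈ hcpInt, ∀ b ∈ hcpInt, ∀ c ∈ hcpInt, sqNormInt (a - b) = 18 → hexLabels a b ⊆ hcpInt → c ∉ hexLabels a b → c - a ∈ hcpInt → c - b ∈ hcpInt → lowerCap hcpInt a b ({c, c - a, c - b} : Finset (Fin 3 → ℤ)) = ({(c - ((c 0 + c 1 + c 2) / 6 * 4) • (1 : Fin 3 → ℤ)), (c - ((c 0 + c 1 + c 2) / 6 * 4) • (1 : Fin 3 → ℤ)) - a, (c - ((c 0 + c 1 + c 2) / 6 * 4) • (1 : Fin 3 → ℤ)) - b} : Finset (Fin 3 → ℤ)) := by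
  decide

/-- STAR (hcp_p): the twelve link labels are exactly the pattern. [folklore] -/
theorem star_image_hcp_p : ∀ a ∈ hcpInt, ∀ b ∈ hcpInt, ∀ c ∈ hcpInt, sqNormInt (a - b) = 18 → hexLabels a b ⊆ hcpInt → c ∉ hexLabels a b → c - a ∈ hcpInt → c - b ∈ hcpInt → (linkOffsets (-1) 1).image (fun y : ℤ × ℤ × ℤ => ((if y.1 = 1 then c else if y.1 = -1 then (c - ((c 0 + c 1 + c 2) / 6 * 4) • (1 : Fin 3 → ℤ)) else 0) - y.2.1 • a - y.2.2 • b)) = hcpInt := by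
  decide

/-- LINK (hcp_p), row of the offset `(-1, 0, 0)` (label `((c - ((c 0 + c 1 + c 2) / 6 * 4) • (1 : Fin 3 → ℤ)))`): touching among the twelve link labels is `linkAdj`. [folklore] -/
theorem linkRow_hcp_p_0 : ∀ y ∈ linkOffsets (-1) 1, ∀ a ∈ hcpInt, ∀ b ∈ hcpInt, ∀ c ∈ hcpInt, sqNormInt (a - b) = 18 → hexLabels a b ⊆ hcpInt → c ∉ hexLabels a b → c - a ∈ hcpInt → c - b ∈ hcpInt → (sqNormInt (((if ((((-1) : ℤ), (0 : ℤ), (0 : ℤ))).1 = 1 then c else if ((((-1) : ℤ), (0 : ℤ), (0 : ℤ))).1 = -1 then (c - ((c 0 + c 1 + c 2) / 6 * 4) • (1 : Fin 3 → ℤ)) else 0) - ((((-1) : ℤ), (0 : ℤ), (0 : ℤ))).2.1 • a - ((((-1) : ℤ), (0 : ℤ), (0 : ℤ))).2.2 • b) - ((if y.1 = 1 then c else if y.1 = -1 then (c - ((c 0 + c 1 + c 2) / 6 * 4) • (1 : Fin 3 → ℤ)) else 0) - y.2.1 • a - y.2.2 • b)) = 18 ↔ linkAdj (-1) 1 (((-1)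 : ℤ), (0 : ℤ), (0 : ℤ)) y) := by
  decide

/-- LINK (hcp_p), row of the offset `(-1, 0, 1)` (label `((c - ((c 0 + c 1 + c 2) / 6 * 4) • (1 : Fin 3 → ℤ)) - b)`): touching among the twelve link labels is `linkAdj`. [folklore] -/
theorem linkRow_hcp_p_1 : ∀ y ∈ linkOffsets (-1) 1, ∀ a ∈ hcpInt, ∀ b ∈ hcpInt, ∀ c ∈ hcpInt, sqNormInt (a - b) = 18 → hexLabels a b ⊆ hcpInt → c ∉ hexLabels a b → c - a ∈ hcpInt → c - b ∈ hcpInt → (sqNormInt (((if ((((-1) : ℤ), (0 : ℤ), (1 : ℤ))).1 = 1 then c else if ((((-1) : ℤ), (0 : ℤ), (1 : ℤ))).1 = -1 then (c - ((c 0 + c 1 + c 2) / 6 * 4) • (1 : Fin 3 → ℤ)) else 0) - ((((-1) : ℤ), (0 : ℤ), (1 : ℤ))).2.1 • a - ((((-1) : ℤ), (0 : ℤ), (1 : ℤ))).2.2 • b) - ((if y.1 = 1 then c else if y.1 = -1 then (c - ((c 0 + c 1 + c 2) / 6 * 4) • (1 : Fin 3 → ℤ)) else 0) - y.2.1 • a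 - y.2.2 • b)) = 18 ↔ linkAdj (-1) 1 (((-1) : ℤ), (0 : ℤ), (1 : ℤ)) y) := by
  decide

/-- LINK (hcp_p), row of the offset `(-1, 1, 0)` (label `((c - ((c 0 + c 1 + c 2) / 6 * 4) • (1 : Fin 3 → ℤ)) - a)`): touching among the twelve link labels is `linkAdj`. [folklore] -/
theorem linkRow_hcp_p_2 : ∀ y ∈ linkOffsets (-1) 1, ∀ a ∈ hcpInt, ∀ b ∈ hcpInt, ∀ c ∈ hcpInt, sqNormInt (a - b) = 18 → hexLabels a b ⊆ hcpInt → c ∉ hexLabels a b → c - a ∈ hcpInt → c - b ∈ hcpInt → (sqNormInt (((if ((((-1) : ℤ), (1 : ℤ), (0 : ℤ))).1 = 1 then c else if ((((-1) : ℤ), (1 : ℤ), (0 : ℤ))).1 = -1 then (c - ((c 0 + c 1 + c 2) / 6 * 4) • (1 : Fin 3 → ℤ)) else 0) - ((((-1) : ℤ), (1 : ℤ), (0 : ℤ))).2.1 • a - ((((-1) : ℤ), (1 : ℤ), (0 : ℤ))).2.2 • b) - ((if y.1 = 1 then c else if y.1 = -1 then (c - ((c 0 + c 1 + c 2) / 6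 * 4) • (1 : Fin 3 → ℤ)) else 0) - y.2.1 • a - y.2.2 • b)) = 18 ↔ linkAdj (-1) 1 (((-1) : ℤ), (1 : ℤ), (0 : ℤ)) y) := by
  decide

/-- LINK (hcp_p), row of the offset `(0, -1, 0)` (label `(a)`): touching among the twelve link labels is `linkAdj`. [folklore] -/
theorem linkRow_hcp_p_3 : ∀ y ∈ linkOffsets (-1) 1, ∀ a ∈ hcpInt, ∀ b ∈ hcpInt, ∀ c ∈ hcpInt, sqNormInt (a - b) = 18 → hexLabels a b ⊆ hcpInt → c ∉ hexLabels a b → c - a ∈ hcpInt → c - b ∈ hcpInt → (sqNormInt (((if (((0 : ℤ), ((-1) : ℤ), (0 : ℤ))).1 = 1 then c else if (((0 : ℤ), ((-1) : ℤ), (0 : ℤ))).1 = -1 then (c - ((c 0 + c 1 + c 2) / 6 * 4) • (1 : Fin 3 → ℤ)) else 0) - (((0 : ℤ), ((-1) : ℤ), (0 : ℤ))).2.1 • a - (((0 : ℤ), ((-1) : ℤ), (0 : ℤ))).2.2 • b) - ((if y.1 = 1 then c else if y.1 = -1 then (c - ((c 0 + c 1 + c 2) / 6 * 4) • (1 : Fin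 3 → ℤ)) else 0) - y.2.1 • a - y.2.2 • b)) = 18 ↔ linkAdj (-1) 1 ((0 : ℤ), ((-1) : ℤ), (0 : ℤ)) y) := by
  decide

end Summit.AtomisticToContinuum.Crystallization.Theorems.PalmUnimodularRigidityShellsToBarlowChart
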